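import Summits.MatrixMultiplication.OmegaCensus.SmallFormats.MatMul22nRankGF7Slack4Search
import HarnessLib

/-!
# ω-census family (a): slack-4 search certificate replay, classes 107–119 (part 3 of 3)

Cell `pub-omega` (unit `pub-omega-tensor-g15`), topic `Summits/MatrixMultiplication/OmegaCensus` (sub-folder `SmallFormats`).
Framing (verbatim): lottery ticket; floor = certified bounds/negative ranges. HONEST FRAMING: kernel replays of the slack-4 search certificate
(`MatMul22nRankGF7Slack4Search`; generated by `pub-omega-tensor-g15/code/gen_runfiles.py`); meaning only through
`MatMul22nRankGF7Slack4SearchSound2.search7_sound`. Nothing here is progress on `ω`.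
-/

namespace Summit.MatrixMultiplication.OmegaCensus.SmallFormats

set_option maxRecDepth 100000 in
set_option maxHeartbeats 40000000 in
/-- `search7 c` for `107 ≤ c < 119` (2464 search nodes). -/
theorem search7_ok_3_1 : ∀ c : Fin 120, 107 ≤ c.val → c.val < 119 → search7 c.val = true := by decide +kernel

set_option maxRecDepth 100000 in
set_option maxHeartbeats 40000000 in
/-- `search7 c` for `119 ≤ c < 120` (374 search nodes). -/
theorem search7_ok_3_2 : ∀ c : Fin 120, 119 ≤ c.val → c.val < 120 → search7 c.val = true := by decide +kernel

/-- `search7 c` for `107 ≤ c < 120`. -/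
theorem search7_ok_3 {c : ℕ} (h1 : 107 ≤ c) (h2 : c < 120) : search7 c = true := by
  by_cases hb1 : c < 119
  · exact search7_ok_3_1 ⟨c, by omega⟩ (by show 107 ≤ c; omega) hb1
  exact search7_ok_3_2 ⟨c, by omega⟩ (by show 119 ≤ c; omega) (by show c < 120; omega)

end Summit.MatrixMultiplication.OmegaCensus.SmallFormats
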